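import Summits.KontsevichZagierPeriods.KontsevichZagierPeriods.Theorems.StandardPartsSpArcLiftingDensityStep
import Summits.KontsevichZagierPeriods.KontsevichZagierPeriods.Theorems.StandardPartsSpArcLiftingDensityNull
import Summits.KontsevichZagierPeriods.KontsevichZagierPeriods.Theorems.StandardPartsSpArcClosureOfSummit
import Summits.KontsevichZagierPeriods.KontsevichZagierPeriods.Theorems.StandardPartsSpArcClosureStubEndpointAeEq
import Literature.NumberTheory.Transcendental.KZCalculusProofs

/-!
# Route StandardParts — `SpArcLifting` (stmt-KontsevichZagierPeriods-3155): KZ classes are `L¹`-dense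
in their value slice; sequential lifting is free; the summit is sequential `L¹`-closedness

Problem `KontsevichZagierPeriods`, route `StandardParts`, crux item stmt-KontsevichZagierPeriods-3155
(`SpArcLifting`), line `registered`, lead c2. Helper file (`--supports`).

The route's thesis splits Conjecture 1 as CLOSURE (KZ-equivalence is closed at `L¹`-endpoints of
arcs of identities) ∧ LIFTING (every equal-valued pair is such an endpoint pair). This file settles,
unconditionally, what happens when "arc" is read as "sequence" (no tameness at all):

* `exists_equivalent_integral_abs_sub_le` — **KZ classes are `L¹`-dense in their value slice**: for
  integral representations `r`, `r'` of the same dimension with `r.value = r'.value` and every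
  `ε > 0` there is `r'' ~ r'` with `∫ |𝟙_{σ''} f'' − 𝟙_σ f| ≤ ε`. Proof: `g = 𝟙_σ f − 𝟙_{σ'} f'` has
  integral `0`, so it is within `ε` of a rational step function `s` with ZERO coefficient sum
  (`exists_step_integral_abs_sub_le_of_integral_eq_zero`); `r'' = [ℝⁿ, 𝟙_{σ'} f' + s]` is
  `KZ.Equivalent` to `r'` because `[ℝⁿ, s]` is a relation (`of_mem_relations_of_step`) and extension
  by zero is a relation; and `𝟙_{σ'} f' + s − 𝟙_σ f = s − g`.
* `approximatePeriodConjecture` — Conjecture 1 up to `ε` in `L¹`, any dimensions, unconditionally.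
* `seqArcLifting` — hence LIFTING IS FREE FOR SEQUENCES: every equal-valued pair (any dimensions, no
  rationality needed) is, up to `KZ.Equivalent`, the `L¹`-endpoint pair of a sequence of identities
  `u k ~ R'` (the `R'`-side constant). Compare the registered stub `stub_rawArcLifting`, which asks
  the same of ONE `ℚ`-semialgebraic family: bounded complexity is exactly what density cannot give.
* `summit_iff_seqClosed` — hence **`KontsevichZagierPeriods ↔` every KZ class is sequentially
  `L¹`-closed in its dimension**. With `spArcLifting_iff_summit` (typed arcs: closure provable by
  rigidity, lifting = summit) this brackets the registered line (raw tame arcs: closure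
  `≥ TameCovLimit`, lifting = Conjecture 1 at rigid pairs) between the two degenerate extremes.

Sources: M. Kontsevich, D. Zagier, *Periods* (2001), §1.2 Conjecture 1 [KontsevichZagier2001];
J. Viu-Sos, Int. J. Number Theory 17 (2021), §4 [ViuSos2021]; M. Yoshinaga, arXiv:0805.0349, §3.4
[Yoshinaga2008].
-/

noncomputable section

namespace Summit.KontsevichZagierPeriods.StandardParts

open MeasureTheory Set Filter Topology
open Literature.NumberTheory.Transcendental
open Literature.NumberTheory.Transcendental.KZ
open Literature.ModelTheory.ExponentialFields (IsSemialgebraic isSemialgebraic_univ)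

variable {n m : ℕ}

/-! ### Values and `L¹` -/

/-- `L¹`-convergence of extended-by-zero integrands along any filter (here: sequences) gives
convergence of values (`|∫ F_k − ∫ F| ≤ ∫ |F_k − F|`; cf. `tendsto_value_of_tendsto_integral_abs_sub`
for real-parameter arcs). [folklore] -/
theorem tendsto_value_of_tendsto_integral_abs_sub' {ι : Type*} {l : Filter ι}
    (u : ι → IntegralRep n) (r : IntegralRep n)
    (h : Tendsto (fun k => ∫ x, |(u k).domain.indicator (u k).integrand x -
      r.domain.indicator r.integrand x|) l (𝓝 0)) :
    Tendsto (fun k => (u k).value) l (𝓝 r.value) := by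
  rw [tendsto_iff_norm_sub_tendsto_zero]
  refine squeeze_zero_norm' (Eventually.of_forall fun k => ?_) h
  rw [norm_norm, Real.norm_eq_abs, integralRep_value_eq_integral_indicator,
    integralRep_value_eq_integral_indicator,
    ← integral_sub (integrable_indicator_integrand _) (integrable_indicator_integrand _)]
  exact abs_integral_le_integral_abs

/-! ### KZ classes are `L¹`-dense in their value slice -/

/-- **KZ classes are `L¹`-dense in their value slice.** If `r`, `r'` are integral representations of
the same dimension with `r.value = r'.value`, then for every `ε > 0` there is an integral
representation `r''` with `KZ.Equivalent r'' r'` and `∫ |𝟙_{σ''} f'' − 𝟙_σ f| ≤ ε`. The witness is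
`r'' = [ℝⁿ, 𝟙_{σ'} f' + s]` for a zero-sum rational step function `s` within `ε` of
`𝟙_σ f − 𝟙_{σ'} f'` (`exists_step_integral_abs_sub_le_of_integral_eq_zero`); `[ℝⁿ, s]` is a
relation (`of_mem_relations_of_step`), extension by zero is a relation, and integrand additivity
glues. So the "approximate period conjecture" is a theorem: Conjecture 1 is entirely about EXACT
identity at bounded complexity. [cite: KontsevichZagier2001, §1.2 Conjecture 1] -/
theorem exists_equivalent_integral_abs_sub_le (r r' : IntegralRep n) (hv : r.value = r'.value)
    {ε : ℝ} (hε : 0 < ε) :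
    ∃ r'' : IntegralRep n, Equivalent r'' r' ∧
      ∫ x, |r''.domain.indicator r''.integrand x - r.domain.indicator r.integrand x| ≤ ε := by
  set F : (Fin n → ℝ) → ℝ := r.domain.indicator r.integrand with hF
  set F' : (Fin n → ℝ) → ℝ := r'.domain.indicator r'.integrand with hF'
  have hFi : Integrable F := integrable_indicator_integrand r
  have hF'i : Integrable F' := integrable_indicator_integrand r'
  set g : (Fin n → ℝ) → ℝ := fun x => F x - F' x with hg
  have hgi : Integrable g := hFi.sub hF'i
  have hg0 : ∫ x, g x = 0 := by
    simp only [hg]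
    rw [integral_sub hFi hF'i, hF, hF', ← integralRep_value_eq_integral_indicator,
      ← integralRep_value_eq_integral_indicator, hv, sub_self]
  obtain ⟨j, L, R, q, _, _, hq0, hsi, hs⟩ :=
    exists_step_integral_abs_sub_le_of_integral_eq_zero g hgi hg0 hε
  set c : Fin n → ℝ := fun _ => (R : ℝ) with hc
  set s : (Fin n → ℝ) → ℝ := fun x => ∑ K ∈ Finset.range (L ^ n),
    (q K : ℝ) * (hoCube j (digits n L K)).indicator 1 (x + c) with hsdef
  have hs1 : ∫ x, |g x - s x| ≤ ε := hs
  -- the step representation and the extension by zero of `r'`, both on `ℝⁿ`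
  let Z : IntegralRep n := ⟨univ, s, isSemialgebraic_univ, isSemialgebraicFunOn_step j L R q,
    integrableOn_univ.2 hsi⟩
  let E : IntegralRep n := ⟨univ, F', isSemialgebraic_univ, isSemialgebraicFunOn_indicator_integrand r',
    integrableOn_univ.2 hF'i⟩
  let r'' : IntegralRep n := ⟨univ, fun x => F' x + s x, isSemialgebraic_univ,
    (IsSemialgebraicFunOn.add_holds (isSemialgebraicFunOn_indicator_integrand r')
      (isSemialgebraicFunOn_step j L R q)).congr fun x _ => rfl,
    integrableOn_univ.2 (hF'i.add hsi)⟩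
  have hZ : of Z ∈ relations := of_mem_relations_of_step q hq0 Z rfl fun x => rfl
  have hE : of E - of r' ∈ relations :=
    of_sub_of_mem_relations_of_indicator E r' (subset_univ _) fun x _ => rfl
  have hadd : of r'' - of E - of Z ∈ relations :=
    integrandAddRel_subset_relations ⟨n, r'', E, Z, rfl, rfl, fun x _ => rfl, rfl⟩
  refine ⟨r'', ?_, ?_⟩
  · show of r'' - of r' ∈ relations
    have : of r'' - of r' = (of r'' - of E - of Z) + (of E - of r') + of Z := by abel
    rw [this]
    exact relations.add_mem (relations.add_mem hadd hE) hZ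
  · have hpt : ∀ x, |r''.domain.indicator r''.integrand x - r.domain.indicator r.integrand x| =
        |g x - s x| := fun x => by
      have e1 : r''.domain.indicator r''.integrand x = F' x + s x := by
        show (univ : Set (Fin n → ℝ)).indicator (fun x => F' x + s x) x = F' x + s x
        rw [indicator_univ]
      have e2 : g x = F x - F' x := rfl
      have e3 : r.domain.indicator r.integrand x = F x := rfl
      rw [e1, e2, e3, abs_sub_comm]
      congr 1
      ring
    exact (integral_congr_ae (Eventually.of_forall hpt)).trans_le hs1

/-- **A sequence of equivalent representations converging in `L¹` to any equal-valued target.**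
(`exists_equivalent_integral_abs_sub_le` with `ε = 1/(k+1)`.) [cite: KontsevichZagier2001, §1.2] -/
theorem exists_seq_equivalent_tendsto (r r' : IntegralRep n) (hv : r.value = r'.value) :
    ∃ u : ℕ → IntegralRep n, (∀ k, Equivalent (u k) r') ∧
      Tendsto (fun k => ∫ x, |(u k).domain.indicator (u k).integrand x -
        r.domain.indicator r.integrand x|) atTop (𝓝 0) := by
  choose u hu hdist using fun k : ℕ =>
    exists_equivalent_integral_abs_sub_le r r' hv (by positivity : (0 : ℝ) < 1 / ((k : ℝ) + 1))
  refine ⟨u, hu, squeeze_zero (fun k => integral_nonneg fun x => abs_nonneg _) hdist ?_⟩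
  exact tendsto_one_div_add_atTop_nhds_zero_nat

/-- **The period conjecture holds up to `ε` in `L¹` ("approximate Conjecture 1", unconditional).**
For integral representations `r`, `r'` of any dimensions with equal values and every `ε > 0` there are,
in a common dimension `N`, representations `R ~ r` and `R'' ~ r'` whose extended-by-zero integrands
are within `ε` in `L¹(ℝᴺ)`. (Raise both to dimension `N = max n m` by
`KZ.IntegralRep.exists_equivalent_of_le`, then `exists_equivalent_integral_abs_sub_le`.) What
Conjecture 1 adds to this theorem is only `ε = 0`. [cite: KontsevichZagier2001, §1.2 Conjecture 1] -/
theorem approximatePeriodConjecture (r : IntegralRep n) (r' : IntegralRep m)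
    (hv : r.value = r'.value) {ε : ℝ} (hε : 0 < ε) :
    ∃ (N : ℕ) (R R'' : IntegralRep N), Equivalent r R ∧ Equivalent r' R'' ∧
      ∫ x, |R''.domain.indicator R''.integrand x - R.domain.indicator R.integrand x| ≤ ε := by
  obtain ⟨R, hR⟩ := r.exists_equivalent_of_le (le_max_left n m)
  obtain ⟨R', hR'⟩ := r'.exists_equivalent_of_le (le_max_right n m)
  have hvR : R.value = R'.value := by
    rw [← Equivalent.value_eq_holds hR, ← Equivalent.value_eq_holds hR', hv]
  obtain ⟨R'', hR'', hdist⟩ := exists_equivalent_integral_abs_sub_le R R' hvR hε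
  exact ⟨max n m, R, R'', hR, hR'.trans hR''.symm, hdist⟩

/-! ### Lifting is free for sequences; the summit is sequential closedness -/

/-- **Sequential arc lifting, unconditionally.** Every equal-valued pair `(r, r')` of integral
representations (any dimensions) is, up to `KZ.Equivalent` (raising both to a common dimension,
`KZ.IntegralRep.exists_equivalent_of_le`), the `L¹`-endpoint pair of a SEQUENCE of identities:
`u k ~ R'` for all `k` and `u k → R` in `L¹`, with `r ~ R`, `r' ~ R'`. This is the registered stub
`stub_rawArcLifting` with "one `ℚ`-semialgebraic family over `(0,1)`" weakened to "a sequence" — and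
in that form it is a theorem, so all the content of the stub is the bounded complexity of a single
semialgebraic family. [cite: KontsevichZagier2001, §1.2 Conjecture 1] -/
theorem seqArcLifting (r : IntegralRep n) (r' : IntegralRep m) (hv : r.value = r'.value) :
    ∃ (N : ℕ) (R R' : IntegralRep N) (u : ℕ → IntegralRep N),
      Equivalent r R ∧ Equivalent r' R' ∧ (∀ k, Equivalent (u k) R') ∧
      Tendsto (fun k => ∫ x, |(u k).domain.indicator (u k).integrand x -
        R.domain.indicator R.integrand x|) atTop (𝓝 0) := by
  obtain ⟨R, hR⟩ := r.exists_equivalent_of_le (le_max_left n m)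
  obtain ⟨R', hR'⟩ := r'.exists_equivalent_of_le (le_max_right n m)
  have hvR : R.value = R'.value := by
    rw [← Equivalent.value_eq_holds hR, ← Equivalent.value_eq_holds hR', hv]
  obtain ⟨u, hu, hlim⟩ := exists_seq_equivalent_tendsto R R' hvR
  exact ⟨max n m, R, R', u, hR, hR', hu, hlim⟩

/-- **The summit is sequential `L¹`-closedness of KZ classes.** `KontsevichZagierPeriods` holds iff,
in every dimension `n`, whenever `u k ~ r'` for all `k` and `u k → r` in `L¹` (extended-by-zero
integrands), already `r ~ r'`. Forward: values pass to the limit (`|v(u k) − v(r)| ≤ ‖u k − r‖₁`),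
so `v(r) = v(r')`, and the summit (freed of `IsRational` by `kzPeriodConjecture'_iff_isRational`)
gives `r ~ r'`. Backward: given an equal-valued pair, raise both to a common dimension and apply
closedness to the free sequential lifting `exists_seq_equivalent_tendsto`. Together with
`spArcLifting_iff_summit` this exhibits the two degenerate extremes of the route's closure/lifting
split — sequences (lifting free, closure = summit) and `IntegralRep`-valued arcs (closure free,
lifting = summit) — between which the registered line over raw tame arcs sits.
[cite: KontsevichZagier2001, §1.2 Conjecture 1] -/
theorem summit_iff_seqClosed :
    KontsevichZagierPeriods ↔
      ∀ ⦃n : ℕ⦄ (r r' : KZ.IntegralRep n) (u : ℕ → KZ.IntegralRep n),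
        (∀ k, KZ.Equivalent (u k) r') →
        Filter.Tendsto (fun k => ∫ x, |(u k).domain.indicator (u k).integrand x -
          r.domain.indicator r.integrand x|) Filter.atTop (𝓝 0) →
        KZ.Equivalent r r' := by
  constructor
  · intro hS n r r' u hu hlim
    have hP : KZPeriodConjecture' := kzPeriodConjecture'_iff_isRational.mpr hS
    apply hP
    have h₁ := tendsto_value_of_tendsto_integral_abs_sub' u r hlim
    have h₂ : Tendsto (fun k => (u k).value) atTop (𝓝 r'.value) :=
      tendsto_const_nhds.congr fun k => (Equivalent.value_eq_holds (hu k)).symm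
    exact tendsto_nhds_unique h₁ h₂
  · intro h n m r r' _ _ hv
    obtain ⟨N, R, R', u, hR, hR', hu, hlim⟩ := seqArcLifting r r' hv
    exact hR.trans ((h R R' u hu hlim).trans hR'.symm)

end Summit.KontsevichZagierPeriods.StandardParts
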